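import Summits.Ventures.PercRepro.C025ProfileGirthPred

/-!
# THE ROW `(q, q+2)` AT GIRTH `≥ q+1` — THE DECOMPOSITION INTO TWO LOCAL INEQUALITIES (night-3 g20)

At girth `≥ q + 1` (every set of at most `q` points independent) the rank-`q` sets are the `q`-subsets (thin) and the
subsets with `≥ q + 1` points of the fat rank-`q` flats; a thin set is GENERIC when its closure adds no point of the
ground set, INNER otherwise.  A `(q+2)`-set is CLEAN when every `(q+1)`-subset is independent (it is then independent
or a `(q+2)`-circuit); a level-`(q+2)` set with no fat subset is exactly a clean one.  This module proves:
* `insert_clean_of_notMem_closure`, `le_rkN_of_clean` — the two facts about clean sets the count needs;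
* **`card_clean_le_card_levelSet_clean`** — `#{clean (q+2)-subsets} ≤ #{S : ρ(S) = q + 2, S clean}` at rank `≥ q + 3`
  (the independent clean sets are level sets; a `(q+2)`-circuit `U` has `≥ 2` extensions `U ∪ y`, `y ∉ cl U`, which are
  clean level sets with `q + 3` points, and a `(q+3)`-set of rank `q + 2` has at most two such sub-circuits: g19's
  `card_le_card_of_girth_pred_family` with `v = q`);
* **`profileIneq_succ_succ_of_parts`** — the row `(q, q+2)` of (Π) (C-032) follows from
  (G1) `Σ_{B generic} price(B) ≤ #{clean (q+2)-subsets}` and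
  (IF) `Σ_{B ∈ Rq not generic} price(B) ≤ #{S : ρ(S) = q + 2, S not clean}`.
Own data (lab/, every matroid of girth `≥ q + 1` and rank `≥ q + 3` on `≤ 9` elements): (G1) and (IF) hold with `0`
violations at `q = 2` (190,400 instances) and `q = 3` (1,005), each tight on some instance; (G1) even in its Hall form.
No `def`, no `instance`, no notation.  Axioms: standard.
-/

open scoped Matroid

namespace PercRepro

open Set Finset ThmH Staged

namespace GirthRows

variable {α : Type} [DecidableEq α] {M : Matroid α} [M.Finite]

omit [DecidableEq α] [M.Finite] in
/-- A subset of a clean set is clean: if every `(q+1)`-subset of `S` is independent and `T ⊆ S`, then every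
`(q+1)`-subset of `T` is independent. -/
theorem clean_subset {q : ℕ} {S T : Finset α} (hS : ∀ X ⊆ S, X.card = q + 1 → M.Indep (X : Set α))
    (hTS : T ⊆ S) : ∀ X ⊆ T, X.card = q + 1 → M.Indep (X : Set α) :=
  fun X hX hXc => hS X (hX.trans hTS) hXc

omit [DecidableEq α] [M.Finite] in
/-- An independent set is clean. -/
theorem clean_of_indep {q : ℕ} {S : Finset α} (hS : M.Indep (S : Set α)) :
    ∀ X ⊆ S, X.card = q + 1 → M.Indep (X : Set α) :=
  fun _ hX _ => hS.subset (Finset.coe_subset.2 hX)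

/-- **Adding a point outside the closure keeps a set clean** (at girth `≥ q + 1`): if every `(q+1)`-subset of `S` is
independent, `y ∈ E` and `y ∉ cl S`, then every `(q+1)`-subset of `S ∪ {y}` is independent. -/
theorem insert_clean_of_notMem_closure {q : ℕ} (hg : ∀ T ⊆ M.E, T.encard ≤ q → M.Indep T) {S : Finset α}
    (hSg : S ⊆ gr M) (hS : ∀ X ⊆ S, X.card = q + 1 → M.Indep (X : Set α)) {y : α} (hy : y ∈ gr M)
    (hyc : y ∉ M.closure (S : Set α)) :
    ∀ X ⊆ insert y S, X.card = q + 1 → M.Indep (X : Set α) := by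
  intro X hX hXc
  by_cases hyX : y ∈ X
  · -- `X = insert y X'` with `X' ⊆ S` of `q` points, independent by the girth; `y ∉ cl X'` since `cl X' ⊆ cl S`
    set X' := X.erase y with hX'
    have hX'S : X' ⊆ S := by
      intro z hz
      rw [hX', Finset.mem_erase] at hz
      have := hX hz.2
      rw [Finset.mem_insert] at this
      exact this.resolve_left hz.1
    have hX'c : X'.card = q := by
      rw [hX', Finset.card_erase_of_mem hyX, hXc]
      rfl
    have hX'E : (X' : Set α) ⊆ M.E := by
      rw [← coe_gr]
      exact_mod_cast hX'S.trans hSg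
    have hX'i : M.Indep (X' : Set α) := by
      apply hg _ hX'E
      rw [Set.encard_coe_eq_coe_finsetCard, hX'c]
    have hyX' : y ∉ X' := by
      rw [hX']
      exact Finset.notMem_erase y X
    have hXeq : X = insert y X' := by
      rw [hX']
      exact (Finset.insert_erase hyX).symm
    rw [hXeq, Finset.coe_insert]
    rw [hX'i.insert_indep_iff_of_notMem hyX']
    refine ⟨?_, ?_⟩
    · rw [← coe_gr]
      exact_mod_cast hy
    · intro hmem
      exact hyc (M.closure_subset_closure (Finset.coe_subset.2 hX'S) hmem)
  · -- `X ⊆ S`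
    have hXS : X ⊆ S := by
      intro z hz
      have := hX hz
      rw [Finset.mem_insert] at this
      rcases this with h | h
      · exact absurd (h ▸ hz) hyX
      · exact h
    exact hS X hXS hXc

omit [DecidableEq α] in
/-- A clean set with at least `q + 1` points has rank `≥ q + 1` (it contains an independent `(q+1)`-subset). -/
theorem le_rkN_of_clean {q : ℕ} {S : Finset α} (hS : ∀ X ⊆ S, X.card = q + 1 → M.Indep (X : Set α))
    (hSc : q + 1 ≤ S.card) : q + 1 ≤ rkN M S := by
  obtain ⟨X, hXS, hXc⟩ := Finset.exists_subset_card_eq hSc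
  have hXi := hS X hXS hXc
  have h1 : M.eRk (X : Set α) ≤ M.eRk (S : Set α) := M.eRk_mono (Finset.coe_subset.2 hXS)
  rw [hXi.eRk_eq_encard, Set.encard_coe_eq_coe_finsetCard, hXc, ← Staged.coe_rkN] at h1
  exact_mod_cast h1

open scoped Classical in
/-- **The clean `(q+2)`-subsets are at most the clean level sets** (rank `≥ q + 3`, girth `≥ q + 1`): an independent
clean set is a level set; a `(q+2)`-circuit `U` extends to the clean level sets `U ∪ {y}`, `y ∉ cl U`
(`insert_clean_of_notMem_closure`), at least two of them, and a `(q+3)`-set of rank `q + 2` holds at most two such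
circuits — g19's double count `card_le_card_of_girth_pred_family` with `v = q` (its rank-`q` branch is empty:
`le_rkN_of_clean`). -/
theorem card_clean_le_card_levelSet_clean {q : ℕ} (hg : ∀ T ⊆ M.E, T.encard ≤ q → M.Indep T)
    (hrank : ((q + 3 : ℕ) : ℕ∞) ≤ M.eRank) :
    (((gr M).powersetCard (q + 2)).filter
        (fun U : Finset α => ∀ X ⊆ U, X.card = q + 1 → M.Indep (X : Set α))).card ≤
      ((Shadow.levelSet M (q + 2)).filter
        (fun S : Finset α => ∀ X ⊆ S, X.card = q + 1 → M.Indep (X : Set α))).card := by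
  apply card_le_card_of_girth_pred_family hg hrank (Finset.filter_subset _ _)
  · -- independent members
    intro S hS hSi
    rw [Finset.mem_filter, Finset.mem_powersetCard] at hS
    rw [Finset.mem_filter, Profile.mem_levelSet]
    refine ⟨⟨hS.1.1, ?_⟩, hS.2⟩
    rw [hSi.eRk_eq_encard, Set.encard_coe_eq_coe_finsetCard, hS.1.2]
  · -- the `(q+2)`-circuits: `S ∪ {y}` is a clean level set
    intro S hS hSr y hyg hyc
    rw [Finset.mem_filter, Finset.mem_powersetCard] at hS
    rw [Finset.mem_filter, Profile.mem_levelSet]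
    refine ⟨⟨Finset.insert_subset hyg hS.1.1, ?_⟩, insert_clean_of_notMem_closure hg hS.1.1 hS.2 hyg hyc⟩
    rw [← Staged.coe_rkN, rkN_insert_of_notMem_closure hyg hyc, hSr]
  · -- no clean `(q+2)`-set has rank `q`
    intro S hS hSr
    rw [Finset.mem_filter, Finset.mem_powersetCard] at hS
    have := le_rkN_of_clean hS.2 (by omega)
    omega

open scoped Classical in
/-- **THE DECOMPOSITION OF THE ROW `(q, q+2)` AT GIRTH `≥ q + 1`** (rank `≥ q + 3`).  With the generic sets
`B ∈ Rq` (`q` points, `cl B ∩ E = B`) and the clean sets (every `(q+1)`-subset independent):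
(G1) `Σ_{B generic} price(B) ≤ #{clean (q+2)-subsets of E}` and
(IF) `Σ_{B ∈ Rq not generic} price(B) ≤ #{S : ρ(S) = q + 2, S not clean}`
give the row `Σ_{B ∈ Rq} price(B) ≤ #{S : ρ(S) = q + 2}` (C-032 at `(q, q+2)`): the clean `(q+2)`-subsets are at most
the clean level sets (`card_clean_le_card_levelSet_clean`), and the level splits into its clean and non-clean parts. -/
theorem profileIneq_succ_succ_of_parts {q : ℕ} (hg : ∀ T ⊆ M.E, T.encard ≤ q → M.Indep T)
    (hrank : ((q + 3 : ℕ) : ℕ∞) ≤ M.eRank)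
    (hG : ∑ B ∈ (Profile.Rq M q).filter
        (fun B : Finset α => B.card = q ∧ ∀ x ∈ gr M, x ∈ M.closure (B : Set α) → x ∈ B),
        Profile.price M q (q + 2) B ≤
      ((((gr M).powersetCard (q + 2)).filter
        (fun U : Finset α => ∀ X ⊆ U, X.card = q + 1 → M.Indep (X : Set α))).card : ℚ))
    (hIF : ∑ B ∈ (Profile.Rq M q).filter
        (fun B : Finset α => ¬ (B.card = q ∧ ∀ x ∈ gr M, x ∈ M.closure (B : Set α) → x ∈ B)),
        Profile.price M q (q + 2) B ≤
      (((Shadow.levelSet M (q + 2)).filter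
        (fun S : Finset α => ¬ ∀ X ⊆ S, X.card = q + 1 → M.Indep (X : Set α))).card : ℚ)) :
    Profile.ProfileIneq M q (q + 2) := by
  unfold Profile.ProfileIneq
  rw [← Finset.sum_filter_add_sum_filter_not (Profile.Rq M q)
    (fun B : Finset α => B.card = q ∧ ∀ x ∈ gr M, x ∈ M.closure (B : Set α) → x ∈ B)]
  rw [← Finset.card_filter_add_card_filter_not
    (fun S : Finset α => ∀ X ⊆ S, X.card = q + 1 → M.Indep (X : Set α)) (s := Shadow.levelSet M (q + 2))]
  have hcount := card_clean_le_card_levelSet_clean hg hrank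
  have hcount' : ((((gr M).powersetCard (q + 2)).filter
      (fun U : Finset α => ∀ X ⊆ U, X.card = q + 1 → M.Indep (X : Set α))).card : ℚ) ≤
      (((Shadow.levelSet M (q + 2)).filter
        (fun S : Finset α => ∀ X ⊆ S, X.card = q + 1 → M.Indep (X : Set α))).card : ℚ) := by
    exact_mod_cast hcount
  push_cast
  linarith

end GirthRows

end PercRepro
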